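import Summits.BirchSwinnertonDyer.Rank1Residual.X12.CMRamifiedRecordSchemaHSat
import Summits.BirchSwinnertonDyer.BirchSwinnertonDyer.Theorems.PrintCFramMordellNoNineTorsionZetaNine
import HarnessLib

/-!
# Leaf `CornerF ∧ CMRamified`, slice `p = 3`: PART H-Sat — the MEANING of the certificate, PROVED:
# a member record that passes `memberOK` names a rational point `G` of `y² = x³ + k` with
# `3Q + t ≠ G` for every rational point `Q` and every rational `3`-torsion point `t`

HONEST FRAMING (cell `bsd-print-cfram`, run/shared/lean/pub/bsd-print-cfram/, verbatim in every file
of the cell): PARTITION currency only — the leaf counts when its class theorem is in the kernel BY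
NAME, flag-free; Literature named facts are statement-only with cite tags, never sorried theorems;
every imported theorem carries its printed hypotheses verbatim; numbers, not adjectives. THIS FILE IS
STRUCTURE: theorems only, no definition, no named fact, nothing about any particular curve; no mark
moves (regime child T = stmt-BirchSwinnertonDyer-20699 of route `PrintCFram` stays OPEN).

WHAT IS HERE (the docstring «MEANING» of `X12/CMRamifiedRecordSchemaHSat.lean` as theorems, from
Mathlib's group law on `WeierstrassCurve.Affine.Point` and the tree's multiplication-by-`n` formula):
* §1 `noDivFrom_sound`, `two_le_and_forall_not_dvd_of_isPrimeTD` — soundness of the records' trial division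
  (`HeegnerIndexRecords.isPrimeTD`), whence primality by `Nat.prime_def_le_sqrt`.
* §2 `x_three_smul_eq` — if `3·(x₀, y₀) = (x_P, y_P)` on `y² = x³ + k` over a field of characteristic `0`
  then `x_P · 9x₀²(x₀³ + 4k)² = x₀⁹ − 96k x₀⁶ + 48k² x₀³ + 64k³` and `9x₀²(x₀³ + 4k)² ≠ 0`
  (tree `zsmul_some_eq_some_φ_div`, `zsmul_some_eq_zero_iff` = Silverman Ex. 3.7 (d),(f); p3's
  `NoZetaNine.mordellCurve_φ_three_evalEval`; p4's `JZeroThree.mordellCurve_Ψ₃_eval`).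
* §3 **`three_smul_ne_of_certX`** — `nonDivThreeCertX k A B p = true`, `P = (x_P, y_P) ∈ E_k(ℚ)` with
  `x_P·B = A` ⟹ `3Q ≠ P` for every `Q ∈ E_k(ℚ)`. Proof = the schema docstring: write
  `x(Q) = a/c` in lowest terms, homogenise the identity of §2 to `B·Φ(a,c) = A·c·Ψ(a,c)` in `ℤ`, reduce
  mod `p`: `p ∣ c` would force `p ∣ B·a⁹`, `p ∣ a` — impossible —, so `a·c⁻¹ mod p` is a root of
  `B·φ₃ − A·ψ₃²`, which the certificate excludes residue by residue.
* §4 `some_add_zero_s` — the abscissa of `(x, y) + (0, σ)` on `y² = x³ + k` (`x ≠ 0`) is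
  `((y − σ)/x)² − x` (Mathlib `add_of_X_ne`), `= 2d(kd³ − σY)/X²` for `(x, y) = (X/d², Y/d³)`, `σ² = k`.
* §5 **`memberOK_sound`** — a passing member record gives `G = (X/d², Y/d³) ∈ E_k(ℚ)` with
  `3Q + t ≠ G` for all `Q` and all `t` with `3t = O` (torsion-free branch: `E_k(ℚ)[3] = O` by
  `JZeroThree.exists_three_torsion_mordellCurve_iff` and the non-residue certificates; `ℤ/3` branch: the
  `3`-torsion is `{O, (0, ±s)}` by `JZeroThree.mordellCurve_three_torsion_x`, and the three translates
  carry certificates); and `memberOK_sound_torsion` — the same for every TORSION `t`, GIVEN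
  `E_k(ℚ)[9] = E_k(ℚ)[3]` (displayed hypothesis `h9`; [cite: SilvermanAEC2009, Exercise 10.19]; p3's
  `NoZetaNine.three_smul_eq_zero_of_nine_smul_eq_zero` proves it over any field with `√−3` and no `ζ₉`),
  via the schema's `translate_ne_of_three_torsion_translates_ne`.
So each display row (`HSatRow.ok_of_hsatCheck` + `HSatRow.sound_of_ok` / `memberOK_sound_torsion`) yields the
kernel statement «the recorded generator is not in `3·E(ℚ) + E(ℚ)_tors`»; with `rank E(ℚ) = 1` this is
`3 ∤ [E(ℚ) : ℤG + E(ℚ)_tors]`: PART H's `ntilde` (of `G`) is the level of every generator modulo torsion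
(the binder of `X12.O11.RamifiedCMEllipticUnitIndexAtThreeT`). beyond-print: NO (Silverman Ex. 3.7 + arithmetic).
-/

set_option autoImplicit false

noncomputable section

open scoped Classical
open WeierstrassCurve Polynomial Literature.NumberTheory.EllipticCurves
open Summit.BirchSwinnertonDyer.BirchSwinnertonDyer.Rank1Residual.HeegnerIndexRecords (isPrimeTD noDivFrom)

namespace Summit.BirchSwinnertonDyer.Rank1Residual.X12.CMRamifiedRecords

/-! ## §1 Trial division is sound -/

/-- `noDivFrom fuel n k = true` with enough fuel (`n < (k + fuel)²`) excludes every divisor `m` of `n`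
with `k ≤ m`, `m² ≤ n`. [folklore] -/
theorem noDivFrom_sound {n : ℕ} : ∀ (fuel k : ℕ), noDivFrom fuel n k = true → n < (k + fuel) * (k + fuel) →
    ∀ m : ℕ, k ≤ m → m * m ≤ n → ¬ m ∣ n
  | 0, k, _, hlt => by
      intro m hkm hmm _
      exact absurd (lt_of_lt_of_le hlt (by simpa using Nat.mul_le_mul hkm hkm)) (not_lt.mpr hmm)
  | fuel + 1, k, h, hlt => by
      intro m hkm hmm hdvd
      unfold noDivFrom at h
      by_cases hk : n < k * k
      · exact absurd (lt_of_lt_of_le hk (Nat.mul_le_mul hkm hkm)) (not_lt.mpr hmm)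
      · rw [if_neg hk] at h
        by_cases hmod : n % k = 0
        · rw [if_pos hmod] at h; exact Bool.false_ne_true h
        · rw [if_neg hmod] at h
          rcases Nat.eq_or_lt_of_le hkm with rfl | hlt'
          · exact hmod (Nat.mod_eq_zero_of_dvd hdvd)
          · exact noDivFrom_sound fuel (k + 1) h (by
              have : k + 1 + fuel = k + (fuel + 1) := by ring
              rw [this]; exact hlt) m hlt' hmm hdvd

/-- **`isPrimeTD n = true ⇒ n` has no divisor `m` with `2 ≤ m ≤ √n`** (the records' trial division,
`HeegnerIndexRecords.isPrimeTD`; primality then follows by `Nat.prime_def_le_sqrt` — the tree's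
`SchoenfeldNumerics.prime_of_isPrimeTD` is the same statement for that file's own copy of the test). [folklore] -/
theorem two_le_and_forall_not_dvd_of_isPrimeTD {n : ℕ} (h : isPrimeTD n = true) :
    2 ≤ n ∧ ∀ m : ℕ, 2 ≤ m → m ≤ Nat.sqrt n → ¬ m ∣ n := by
  simp only [isPrimeTD, Bool.and_eq_true, decide_eq_true_eq] at h
  exact ⟨h.1, fun m hm2 hms => noDivFrom_sound n 2 h.2 (by nlinarith) m hm2 (Nat.le_sqrt.mp hms)⟩

/-! ## §2 The abscissa of `3Q` on `y² = x³ + k` -/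

section Field

variable {F : Type*} [Field F] [DecidableEq F]

/-- **`x(3Q)·ψ₃(Q)² = φ₃(Q)` on `y² = x³ + k`.** If `3·(x₀, y₀) = (x_P, y_P)` then
`x_P · 9x₀²(x₀³ + 4k)² = x₀⁹ − 96k x₀⁶ + 48k² x₀³ + 64k³` and `9x₀²(x₀³ + 4k)² ≠ 0`.
[cite: SilvermanAEC2009, Exercise 3.7 (d),(f)] -/
theorem x_three_smul_eq {k x₀ y₀ xP yP : F} (h₀ : (mordellCurve k).toAffine.Nonsingular x₀ y₀)
    (hP : (mordellCurve k).toAffine.Nonsingular xP yP)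
    (h3 : (3 : ℕ) • (Affine.Point.some x₀ y₀ h₀ : (mordellCurve k).toAffine.Point) = .some xP yP hP) :
    xP * (9 * x₀ ^ 2 * (x₀ ^ 3 + 4 * k) ^ 2) =
        x₀ ^ 9 - 96 * k * x₀ ^ 6 + 48 * k ^ 2 * x₀ ^ 3 + 64 * k ^ 3 ∧
      9 * x₀ ^ 2 * (x₀ ^ 3 + 4 * k) ^ 2 ≠ 0 := by
  have heq : y₀ ^ 2 = x₀ ^ 3 + k := (mordellCurve_equation_iff k x₀ y₀).mp h₀.left
  have h3z : (3 : ℤ) • (Affine.Point.some x₀ y₀ h₀ : (mordellCurve k).toAffine.Point) = .some xP yP hP := by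
    rw [show (3 : ℤ) = ((3 : ℕ) : ℤ) from rfl, natCast_zsmul]; exact h3
  have hψ : ((mordellCurve k).ψ 3).evalEval x₀ y₀ ≠ 0 := by
    intro hψ0
    have := (Affine.Point.zsmul_some_eq_zero_iff h₀ 3).mpr hψ0
    rw [h3z] at this
    exact Affine.Point.some_ne_zero hP this
  have hψeval : ((mordellCurve k).ψ 3).evalEval x₀ y₀ = 3 * x₀ * (x₀ ^ 3 + 4 * k) := by
    rw [WeierstrassCurve.ψ_three, evalEval_C, JZeroThree.mordellCurve_Ψ₃_eval]
  obtain ⟨y₁, hns, e⟩ := Affine.Point.zsmul_some_eq_some_φ_div h₀ hψ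
  rw [h3z] at e
  have hx : xP = ((mordellCurve k).φ 3).evalEval x₀ y₀ / ((mordellCurve k).ψ 3).evalEval x₀ y₀ ^ 2 := by
    injection e with hx _
  rw [eq_div_iff (pow_ne_zero 2 hψ),
    Summit.BirchSwinnertonDyer.BirchSwinnertonDyer.Theorems.PrintCFram.NoZetaNine.mordellCurve_φ_three_evalEval
      heq, hψeval] at hx
  have hne : 9 * x₀ ^ 2 * (x₀ ^ 3 + 4 * k) ^ 2 ≠ 0 := by
    have : (3 * x₀ * (x₀ ^ 3 + 4 * k)) ^ 2 ≠ 0 := by rw [← hψeval]; exact pow_ne_zero 2 hψ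
    exact fun h0 => this (by linear_combination h0)
  exact ⟨by linear_combination hx, hne⟩

/-- The abscissa of `(x, y) + (0, σ)` on `y² = x³ + k` for `x ≠ 0`: `((y − σ)/x)² − x`. [cite: SilvermanAEC2009, III.2.3] -/
theorem some_add_zero_s {k x y σ : F} (h : (mordellCurve k).toAffine.Nonsingular x y)
    (hσ : (mordellCurve k).toAffine.Nonsingular 0 σ) (hx : x ≠ 0) :
    ∃ (y₃ : F) (h₃ : (mordellCurve k).toAffine.Nonsingular (((y - σ) / x) ^ 2 - x) y₃),
      (Affine.Point.some x y h : (mordellCurve k).toAffine.Point) + .some 0 σ hσ = .some _ y₃ h₃ := by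
  have hadd := Affine.Point.add_of_X_ne (W := mordellCurve k) (h₁ := h) (h₂ := hσ) hx
  have hX : (mordellCurve k).toAffine.addX x 0 ((mordellCurve k).toAffine.slope x 0 y σ) =
      ((y - σ) / x) ^ 2 - x := by
    rw [Affine.slope_of_X_ne hx, Affine.addX]
    simp [mordellCurve]
  refine ⟨_, ?_, hadd.trans (MordellDescent.point_some_ext hX rfl)⟩
  rw [← hX]
  exact Affine.nonsingular_add h hσ fun hxy => hx hxy.left

end Field

/-! ## §3 The certificate excludes `3Q = P` -/

/-- Cast of `phi3M`. [folklore] -/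
theorem cast_phi3M {R : Type*} [CommRing R] (k x : ℤ) : ((phi3M k x : ℤ) : R) =
    (x : R) ^ 9 - 96 * (k : R) * (x : R) ^ 6 + 48 * (k : R) ^ 2 * (x : R) ^ 3 + 64 * (k : R) ^ 3 := by
  simp only [phi3M]; push_cast; ring

/-- Cast of `psi3SqM`. [folklore] -/
theorem cast_psi3SqM {R : Type*} [CommRing R] (k x : ℤ) :
    ((psi3SqM k x : ℤ) : R) = 9 * (x : R) ^ 2 * ((x : R) ^ 3 + 4 * (k : R)) ^ 2 := by
  simp only [psi3SqM]; push_cast; ring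

/-- **The certificate is sound: `nonDivThreeCertX k A B p = true` and `P = (x_P, y_P) ∈ E_k(ℚ)` with
`x_P · B = A` ⟹ `3Q ≠ P` for every `Q ∈ E_k(ℚ)`** (module docstring §3; `B ≠ 0` follows from `p ∤ B`).
[cite: SilvermanAEC2009, Exercise 3.7 (d)] -/
theorem three_smul_ne_of_certX {k A B : ℤ} {p : ℕ} (hc : nonDivThreeCertX k A B p = true)
    {xP yP : ℚ} (hP : (mordellCurve (k : ℚ)).toAffine.Nonsingular xP yP)
    (hx : xP * (B : ℚ) = (A : ℚ)) (Q : (mordellCurve (k : ℚ)).toAffine.Point) :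
    (3 : ℕ) • Q ≠ .some xP yP hP := by
  obtain ⟨hprime, hBp, hall⟩ := (nonDivThreeCertX_iff k A B p).mp hc
  haveI : Fact p.Prime := ⟨Nat.prime_def_le_sqrt.mpr (two_le_and_forall_not_dvd_of_isPrimeTD hprime)⟩
  intro hQ
  rcases Q with _ | ⟨x₀, y₀, h₀⟩
  · have h0 : (3 : ℕ) • (0 : (mordellCurve (k : ℚ)).toAffine.Point) = 0 := nsmul_zero 3
    exact Affine.Point.some_ne_zero hP (hQ.symm.trans h0)
  obtain ⟨hid, hψ⟩ := x_three_smul_eq h₀ hP hQ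
  -- `B·φ(x₀) = A·ψ²(x₀)` in `ℚ`
  have h1 : (B : ℚ) * (x₀ ^ 9 - 96 * (k : ℚ) * x₀ ^ 6 + 48 * (k : ℚ) ^ 2 * x₀ ^ 3 + 64 * (k : ℚ) ^ 3) =
      (A : ℚ) * (9 * x₀ ^ 2 * (x₀ ^ 3 + 4 * (k : ℚ)) ^ 2) := by
    rw [← hid, ← hx]; ring
  -- lowest terms `x₀ = a/c`
  set a : ℤ := x₀.num with ha
  set c : ℕ := x₀.den with hcdef
  have hc0 : (c : ℚ) ≠ 0 := by exact_mod_cast x₀.den_nz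
  have ex : x₀ = (a : ℚ) / (c : ℚ) := (Rat.num_div_den x₀).symm
  -- homogenised identity in `ℤ`
  have h2 : ((B * (a ^ 9 - 96 * k * a ^ 6 * (c : ℤ) ^ 3 + 48 * k ^ 2 * a ^ 3 * (c : ℤ) ^ 6 +
      64 * k ^ 3 * (c : ℤ) ^ 9) - A * (c : ℤ) * (9 * a ^ 2 * (a ^ 3 + 4 * k * (c : ℤ) ^ 3) ^ 2) : ℤ) : ℚ) = 0 := by
    have key : ((B : ℚ) * (x₀ ^ 9 - 96 * (k : ℚ) * x₀ ^ 6 + 48 * (k : ℚ) ^ 2 * x₀ ^ 3 + 64 * (k : ℚ) ^ 3) -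
        (A : ℚ) * (9 * x₀ ^ 2 * (x₀ ^ 3 + 4 * (k : ℚ)) ^ 2)) * (c : ℚ) ^ 9 =
        (B : ℚ) * ((a : ℚ) ^ 9 - 96 * (k : ℚ) * (a : ℚ) ^ 6 * (c : ℚ) ^ 3 +
          48 * (k : ℚ) ^ 2 * (a : ℚ) ^ 3 * (c : ℚ) ^ 6 + 64 * (k : ℚ) ^ 3 * (c : ℚ) ^ 9) -
        (A : ℚ) * (c : ℚ) * (9 * (a : ℚ) ^ 2 * ((a : ℚ) ^ 3 + 4 * (k : ℚ) * (c : ℚ) ^ 3) ^ 2) := by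
      rw [ex]; field_simp
    push_cast
    rw [← key, h1]
    ring
  have h3 : (B * (a ^ 9 - 96 * k * a ^ 6 * (c : ℤ) ^ 3 + 48 * k ^ 2 * a ^ 3 * (c : ℤ) ^ 6 +
      64 * k ^ 3 * (c : ℤ) ^ 9) - A * (c : ℤ) * (9 * a ^ 2 * (a ^ 3 + 4 * k * (c : ℤ) ^ 3) ^ 2) : ℤ) = 0 := by
    exact_mod_cast h2
  -- reduce mod `p`
  have hBz : ((B : ℤ) : ZMod p) ≠ 0 := by
    rw [ne_eq, ZMod.intCast_zmod_eq_zero_iff_dvd]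
    exact fun hd => hBp (Int.emod_eq_zero_of_dvd hd)
  have h4 := congrArg (Int.cast : ℤ → ZMod p) h3
  push_cast at h4
  by_cases hpc : ((c : ℤ) : ZMod p) = 0
  · -- `p ∣ c ⇒ p ∣ B a⁹ ⇒ p ∣ a`: contradicts `gcd(a, c) = 1`
    rw [show ((c : ℕ) : ZMod p) = ((c : ℤ) : ZMod p) by push_cast; rfl, hpc] at h4
    have hBa : ((B : ℤ) : ZMod p) * ((a : ℤ) : ZMod p) ^ 9 = 0 := by linear_combination h4
    rcases mul_eq_zero.mp hBa with hB0 | ha0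
    · exact hBz hB0
    · have ha0' : ((a : ℤ) : ZMod p) = 0 := pow_eq_zero_iff (by norm_num) |>.mp ha0
      rw [ZMod.intCast_zmod_eq_zero_iff_dvd] at ha0'
      have hpc' : (p : ℤ) ∣ (c : ℤ) := (ZMod.intCast_zmod_eq_zero_iff_dvd _ p).mp hpc
      have hcop : Int.gcd a (c : ℤ) = 1 := by
        rw [ha, hcdef]; exact_mod_cast x₀.reduced
      have hdvd : (p : ℤ) ∣ (Int.gcd a (c : ℤ) : ℤ) := Int.dvd_coe_gcd ha0' hpc'
      rw [hcop] at hdvd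
      have : p ∣ 1 := by exact_mod_cast hdvd
      exact (Fact.out : p.Prime).one_lt.ne' (Nat.dvd_one.mp this)
  · -- `c` is a unit mod `p`: `x̄ = a c⁻¹` is a root of `B φ₃ − A ψ₃²`
    set cb : ZMod p := ((c : ℤ) : ZMod p) with hcb
    set xb : ZMod p := ((a : ℤ) : ZMod p) * cb⁻¹ with hxb
    have hcc : ((c : ℕ) : ZMod p) = cb := by rw [hcb]; push_cast; rfl
    rw [hcc] at h4
    have hax : ((a : ℤ) : ZMod p) = xb * cb := by rw [hxb, mul_assoc, inv_mul_cancel₀ hpc, mul_one]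
    rw [hax] at h4
    have h5 : cb ^ 9 * (((B : ℤ) : ZMod p) * (xb ^ 9 - 96 * ((k : ℤ) : ZMod p) * xb ^ 6 +
        48 * ((k : ℤ) : ZMod p) ^ 2 * xb ^ 3 + 64 * ((k : ℤ) : ZMod p) ^ 3) -
        ((A : ℤ) : ZMod p) * (9 * xb ^ 2 * (xb ^ 3 + 4 * ((k : ℤ) : ZMod p)) ^ 2)) = 0 := by
      linear_combination h4
    have h6 : ((B : ℤ) : ZMod p) * (xb ^ 9 - 96 * ((k : ℤ) : ZMod p) * xb ^ 6 +
        48 * ((k : ℤ) : ZMod p) ^ 2 * xb ^ 3 + 64 * ((k : ℤ) : ZMod p) ^ 3) -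
        ((A : ℤ) : ZMod p) * (9 * xb ^ 2 * (xb ^ 3 + 4 * ((k : ℤ) : ZMod p)) ^ 2) = 0 := by
      rcases mul_eq_zero.mp h5 with h | h
      · exact absurd (pow_eq_zero_iff (by norm_num) |>.mp h) hpc
      · exact h
    -- the residue `n = xb.val < p` violates the certificate
    have hn : xb.val < p := ZMod.val_lt xb
    apply hall xb.val hn
    apply Int.emod_eq_zero_of_dvd
    rw [← ZMod.intCast_zmod_eq_zero_iff_dvd]
    push_cast
    rw [cast_phi3M, cast_psi3SqM]
    have hxn : ((xb.val : ℕ) : ZMod p) = xb := ZMod.natCast_zmod_val xb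
    rw [show (((xb.val : ℕ) : ℤ) : ZMod p) = ((xb.val : ℕ) : ZMod p) by push_cast; rfl, hxn]
    linear_combination h6

/-! ## §4 Rational points from a member record -/

/-- The recorded point `G = (X/d², Y/d³)` of a member record is a nonsingular point of `y² = x³ + k`.
[folklore] -/
theorem nonsingular_gen_of_memberOK {k X Y : ℤ} {d p₀ s pp pm q₁ q₂ q₃ : ℕ}
    (h : memberOK k X Y d p₀ s pp pm q₁ q₂ q₃ = true) :
    (mordellCurve (k : ℚ)).toAffine.Nonsingular ((X : ℚ) / (d : ℚ) ^ 2) ((Y : ℚ) / (d : ℚ) ^ 3) := by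
  obtain ⟨hk, hd, hcurve, -⟩ := memberOK_common h
  have hkQ : ((k : ℤ) : ℚ) ≠ 0 := by exact_mod_cast hk
  have hdQ : (d : ℚ) ≠ 0 := by exact_mod_cast (show d ≠ 0 by omega)
  apply nonsingular_mordellCurve_of_equation hkQ
  rw [mordellCurve_equation_iff]
  have hc : ((Y : ℤ) : ℚ) ^ 2 = ((X : ℤ) : ℚ) ^ 3 + (k : ℚ) * (d : ℚ) ^ 6 := by exact_mod_cast hcurve
  field_simp
  linear_combination hc

/-- **`3Q ≠ G`** for the recorded point of a passing member record. [folklore] -/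
theorem three_smul_ne_gen_of_memberOK {k X Y : ℤ} {d p₀ s pp pm q₁ q₂ q₃ : ℕ}
    (h : memberOK k X Y d p₀ s pp pm q₁ q₂ q₃ = true) (Q : (mordellCurve (k : ℚ)).toAffine.Point) :
    (3 : ℕ) • Q ≠ .some _ _ (nonsingular_gen_of_memberOK h) := by
  obtain ⟨hk, hd, hcurve, hcert⟩ := memberOK_common h
  have hdQ : (d : ℚ) ≠ 0 := by exact_mod_cast (show d ≠ 0 by omega)
  refine three_smul_ne_of_certX hcert _ ?_ Q
  push_cast
  field_simp

/-- In the `ℤ/3` branch (`s ≠ 0`): the rational points `(0, ±s)`. [folklore] -/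
theorem nonsingular_zero_of_memberOK {k X Y : ℤ} {d p₀ s pp pm q₁ q₂ q₃ : ℕ}
    (h : memberOK k X Y d p₀ s pp pm q₁ q₂ q₃ = true) (hs : s ≠ 0) {σ : ℚ}
    (hσ : σ = (s : ℚ) ∨ σ = -(s : ℚ)) : (mordellCurve (k : ℚ)).toAffine.Nonsingular 0 σ := by
  have hsk := (memberOK_threeTorsion h hs).1
  have hσk : σ ^ 2 = (k : ℚ) := by
    rcases hσ with rfl | rfl <;> [skip; rw [neg_sq]] <;> exact_mod_cast hsk
  apply nonsingular_mordellCurve_of_equation (by exact_mod_cast (memberOK_common h).1)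
  rw [mordellCurve_equation_iff, hσk]; ring

/-- **`3Q ≠ G + (0, σ)`** for `σ = ±s` in the `ℤ/3` branch: the abscissa of `G + (0, σ)` times `X²` is
`2d(kd³ − σY) = 2sd(sd³ ∓ Y)`, and the translate certificate applies. [folklore] -/
theorem three_smul_ne_gen_add_of_memberOK {k X Y : ℤ} {d p₀ s pp pm q₁ q₂ q₃ : ℕ}
    (h : memberOK k X Y d p₀ s pp pm q₁ q₂ q₃ = true) (hs : s ≠ 0) {σ : ℚ}
    (hσ : σ = (s : ℚ) ∨ σ = -(s : ℚ)) (Q : (mordellCurve (k : ℚ)).toAffine.Point) :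
    (3 : ℕ) • Q ≠ .some _ _ (nonsingular_gen_of_memberOK h) +
      .some 0 σ (nonsingular_zero_of_memberOK h hs hσ) := by
  obtain ⟨hk, hd, hcurve, -⟩ := memberOK_common h
  obtain ⟨hsk, hX, hpp, hpm⟩ := memberOK_threeTorsion h hs
  have hdQ : (d : ℚ) ≠ 0 := by exact_mod_cast (show d ≠ 0 by omega)
  have hXQ : ((X : ℤ) : ℚ) ≠ 0 := by exact_mod_cast hX
  have hxG : ((X : ℤ) : ℚ) / (d : ℚ) ^ 2 ≠ 0 := div_ne_zero hXQ (pow_ne_zero 2 hdQ)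
  obtain ⟨y₃, h₃, hadd⟩ := some_add_zero_s (nonsingular_gen_of_memberOK h)
    (nonsingular_zero_of_memberOK h hs hσ) hxG
  rw [hadd]
  have hc : ((Y : ℤ) : ℚ) ^ 2 = ((X : ℤ) : ℚ) ^ 3 + (k : ℚ) * (d : ℚ) ^ 6 := by exact_mod_cast hcurve
  have hsQ : ((s : ℤ) : ℚ) ^ 2 = (k : ℚ) := by exact_mod_cast hsk
  push_cast at hsQ
  rcases hσ with rfl | rfl
  · refine three_smul_ne_of_certX hpp _ ?_ Q
    push_cast
    field_simp
    linear_combination hc - (d : ℚ) ^ 6 * hsQ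
  · refine three_smul_ne_of_certX hpm _ ?_ Q
    push_cast
    field_simp
    linear_combination hc - (d : ℚ) ^ 6 * hsQ

/-! ## §5 Soundness of a member record -/

/-- When `k = s²` (`s ≠ 0`) every rational point killed by `3` on `y² = x³ + k` is `O`, `(0, s)` or `(0, −s)`
(`JZeroThree.mordellCurve_three_torsion_x`; the second kind `x³ = −4k, y² = −3k` is impossible since
`−3k < 0`). [cite: SilvermanAEC2009, Exercise 10.19] -/
theorem three_torsion_of_sq {k : ℤ} {s : ℕ} (hs : s ≠ 0) (hsk : (s : ℤ) ^ 2 = k)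
    (t : (mordellCurve (k : ℚ)).toAffine.Point) (ht : (3 : ℕ) • t = 0) :
    t = 0 ∨ (∃ h, t = .some 0 (s : ℚ) h) ∨ (∃ h, t = .some 0 (-(s : ℚ)) h) := by
  rcases t with _ | ⟨x, y, hxy⟩
  · exact Or.inl rfl
  -- (`convert`: the tree lemma is stated with the classical `DecidableEq`; instances are subsingletons)
  rcases JZeroThree.mordellCurve_three_torsion_x (F := ℚ) hxy (by convert ht) with ⟨hx, hy⟩ | ⟨-, hy⟩
  · have hsQ : ((s : ℤ) : ℚ) ^ 2 = (k : ℚ) := by exact_mod_cast hsk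
    push_cast at hsQ
    have hy2 : (y - s) * (y + s) = 0 := by linear_combination hy - hsQ
    rcases mul_eq_zero.mp hy2 with h1 | h1
    · exact Or.inr (Or.inl ⟨hx ▸ (show y = (s : ℚ) by linarith) ▸ hxy,
        MordellDescent.point_some_ext hx (by linarith)⟩)
    · exact Or.inr (Or.inr ⟨hx ▸ (show y = -(s : ℚ) by linarith) ▸ hxy,
        MordellDescent.point_some_ext hx (by linarith)⟩)
  · exfalso
    have hk0 : (0 : ℚ) < (k : ℚ) := by
      have hs0 : (0 : ℤ) < (s : ℤ) ^ 2 := by positivity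
      exact_mod_cast (hsk ▸ hs0)
    nlinarith [sq_nonneg y]

/-- **Soundness of a member record (both branches): `3Q + t ≠ G` for every rational `Q` and every
rational `t` with `3t = O`**, `G = (X/d², Y/d³)` the recorded point. Torsion-free branch: `E_k(ℚ)[3] = O`
from the non-residue certificates via `JZeroThree.exists_three_torsion_mordellCurve_iff`; `ℤ/3` branch:
`three_torsion_of_sq` and the three certificates. [folklore] -/
theorem memberOK_sound {k X Y : ℤ} {d p₀ s pp pm q₁ q₂ q₃ : ℕ}
    (h : memberOK k X Y d p₀ s pp pm q₁ q₂ q₃ = true)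
    (t : (mordellCurve (k : ℚ)).toAffine.Point) (ht : (3 : ℕ) • t = 0)
    (Q : (mordellCurve (k : ℚ)).toAffine.Point) :
    (3 : ℕ) • Q + t ≠ .some _ _ (nonsingular_gen_of_memberOK h) := by
  have hk : ((k : ℤ) : ℚ) ≠ 0 := by exact_mod_cast (memberOK_common h).1
  by_cases hs : s = 0
  · -- torsion-free branch: `t = 0`
    obtain ⟨hnsq, hrest⟩ := memberOK_torsionFree h hs
    have ht0 : t = 0 := by
      by_contra hne
      rcases (JZeroThree.exists_three_torsion_mordellCurve_iff (F := ℚ) hk).mp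
        ⟨t, hne, by convert ht⟩ with hsq | ⟨hsq, hcube⟩
      · exact hnsq hsq
      · rcases hrest with h1 | h1
        · exact h1 (by push_cast; exact hsq)
        · exact h1 (by push_cast; exact hcube)
    rw [ht0, add_zero]
    exact three_smul_ne_gen_of_memberOK h Q
  · -- `ℤ/3` branch
    have hsk := (memberOK_threeTorsion h hs).1
    intro hG
    have hQ : (3 : ℕ) • Q = .some _ _ (nonsingular_gen_of_memberOK h) - t := eq_sub_of_add_eq hG
    rcases three_torsion_of_sq hs hsk t ht with rfl | ⟨h0, rfl⟩ | ⟨h0, rfl⟩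
    · rw [sub_zero] at hQ
      exact three_smul_ne_gen_of_memberOK h Q hQ
    · -- `t = (0, s)`: `3Q = G − (0, s) = G + (0, −s)`
      apply three_smul_ne_gen_add_of_memberOK h hs (σ := -(s : ℚ)) (Or.inr rfl) Q
      rw [hQ, sub_eq_add_neg, Affine.Point.neg_some]
      congr 1
      exact MordellDescent.point_some_ext rfl (mordellCurve_negY _ _ _)
    · -- `t = (0, −s)`: `3Q = G + (0, s)`
      apply three_smul_ne_gen_add_of_memberOK h hs (σ := (s : ℚ)) (Or.inl rfl) Q
      rw [hQ, sub_eq_add_neg, Affine.Point.neg_some]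
      congr 1
      exact MordellDescent.point_some_ext rfl (by rw [mordellCurve_negY, neg_neg])

/-- **Soundness, torsion form: `3Q + t ≠ G` for every rational `Q` and every rational TORSION point
`t`**, GIVEN that the `3`-power torsion of `E_k(ℚ)` is killed by `3` (`h9`, no rational point of order
`9` on `y² = x³ + k` [cite: SilvermanAEC2009, Exercise 10.19]; p3's `NoZetaNine` theorem over `ℚ(√−3)`).
So the recorded point is not in `3·E_k(ℚ) + E_k(ℚ)_tors`; with `rank E_k(ℚ) = 1`,
`3 ∤ [E_k(ℚ) : ℤG + E_k(ℚ)_tors]`. [folklore] -/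
theorem memberOK_sound_torsion {k X Y : ℤ} {d p₀ s pp pm q₁ q₂ q₃ : ℕ}
    (h : memberOK k X Y d p₀ s pp pm q₁ q₂ q₃ = true)
    (h9 : ∀ t : (mordellCurve (k : ℚ)).toAffine.Point, 9 • t = 0 → 3 • t = 0)
    {t : (mordellCurve (k : ℚ)).toAffine.Point} (ht : IsOfFinAddOrder t)
    (Q : (mordellCurve (k : ℚ)).toAffine.Point) :
    (3 : ℕ) • Q + t ≠ .some _ _ (nonsingular_gen_of_memberOK h) :=
  translate_ne_of_three_torsion_translates_ne (fun t' ht' Q' => memberOK_sound h t' ht' Q') h9 ht Q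

/-- **Row form**: both members of an `ok` row (as delivered by a display theorem via
`HSatRow.ok_of_hsatCheck`). [folklore] -/
theorem HSatRow.sound_of_ok {r : HSatRow} (h : r.ok = true) :
    (∀ (t : (mordellCurve (r.k : ℚ)).toAffine.Point), (3 : ℕ) • t = 0 →
      ∀ Q : (mordellCurve (r.k : ℚ)).toAffine.Point,
        (3 : ℕ) • Q + t ≠ .some _ _ (nonsingular_gen_of_memberOK ((HSatRow.ok_iff r).mp h).1)) ∧
    (∀ (t : (mordellCurve (r.k' : ℚ)).toAffine.Point), (3 : ℕ) • t = 0 →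
      ∀ Q : (mordellCurve (r.k' : ℚ)).toAffine.Point,
        (3 : ℕ) • Q + t ≠ .some _ _ (nonsingular_gen_of_memberOK ((HSatRow.ok_iff r).mp h).2)) :=
  ⟨fun t ht Q => memberOK_sound ((HSatRow.ok_iff r).mp h).1 t ht Q,
    fun t ht Q => memberOK_sound ((HSatRow.ok_iff r).mp h).2 t ht Q⟩

end Summit.BirchSwinnertonDyer.Rank1Residual.X12.CMRamifiedRecords

end
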